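import Literature.NumberTheory.Automorphic.ArchHeckeTestVectorGammaGL2
import Literature.NumberTheory.Automorphic.ArchUnitarityBoundsGL2Complex
import Literature.NumberTheory.Automorphic.ArchUnitarityBoundsGL2RealWeightOne
import HarnessLib

/-!
# The tagged archimedean test vector of `GL₂(K_∞)` with its unitarity data
# (Jacquet–Langlands (1970), Thm. 5.15, 6.4, proof of Thm. 11.1; Humphries–Jo (2024), Thm. 5.6)

Topic `NumberTheory/Automorphic`; namespace `Literature.NumberTheory.Automorphic`. Theorems only (no
definition, no named fact, no instance). The test-vector input (R3) of the Humphries–Jo route to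
`HumphriesJo2024_archRankinSelberg_testVector 2 K`: `exists_taggedTestVector_unitarityData` packages, for an
irreducible unitary `τ` of `GL₂(K_∞)` with a non-zero continuous Whittaker functional, the Hecke test vector of
`ArchHeckeTestVectorConstructionGL2` / `ArchHeckeTestVectorGammaGL2` — a non-zero `K_∞`-finite Gårding vector `e`
tagged at every place, whose Kirillov function factors as `C ∏_w S_{t_w}` (`C ≠ 0`) — TOGETHER WITH the central
scalars of the places and the unitarity bounds on the parameters of its tags, in the refined form consumed by the
Gamma bookkeeping `rsGammaProduct_archRankinSelberg_tagged₂` (`ArchRankinSelbergGammaTaggedGL2`):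

* real places (`ArchUnitarityBoundsGL2Real`, `…WeightOne`): `re μ_w = 0`; `discPlus k`: `k ≥ 1`; `weightOneSym κ`:
  `re κ = 0` (the inner weight-one vector is non-zero); `weightZero`: `|im ν| < ½` (`e` itself is `K_∞`-finite);
  `weightZeroX`: `|im ν| ≤ ½` (the inner weight-zero vector is non-zero);
* complex places (`ArchUnitarityBoundsGL2Complex`): `re μ₁ = re μ₂ = 0`; `|im ν^a|, |im ν^h| ≤ m/2 + 1` (the inner
  highest vector `y` is non-zero; `|im ν^h| = |im ν^a|`); `holPow b`: strict (`b = 0`: `y = e`; `b ≥ 1`: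
  `τ^h(E₀₁) y ≠ 0`); `antiPowLowest 0`: strict (`y = c · τ(R_w⁻¹) e` by the Weyl datum, a `K_∞`-translate of `e`,
  `R_w = exp((π/2)(E₀₁-E₁₀) ⊗ c_w) ∈ K_∞`); `string j`: `im ν^a = m/2` (`exists_string_relation`,
  `im_besselParamC_eq_half_of_string`) and `j ≤ m`.

Since the pair `(e, e')` of such vectors for `τ, τ'` needs NO matching (every real tag is `δ_w`-even, every
complex tag satisfies the torus condition `it + μ₂ = 0`), the same vector serves `τ` whatever the partner.

## References

* H. Jacquet, R. P. Langlands, *Automorphic Forms on GL(2)*, LNM 114 (1970), §5 Thm. 5.13–5.15, §6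
  Thm. 6.2–6.4, §11 [JacquetLanglands1970].
* P. Humphries, Y. Jo, *Test vectors for archimedean period integrals*, Publ. Mat. 68 (2024), Thm. 5.6
  [HumphriesJo2024].
* A. W. Knapp, *Representation Theory of Semisimple Groups* (1986), Ch. XVI §1 [Knapp1986].
-/

noncomputable section

open MeasureTheory Measure NumberField NumberField.InfinitePlace NumberField.mixedEmbedding IsDedekindDomain Set Filter
open scoped MatrixGroups Topology Classical InnerProductSpace ComplexConjugate

namespace Literature.NumberTheory.Automorphic

-- as in `ArchGardingWhittaker`
set_option backward.isDefEq.respectTransparency false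

variable {K : Type} [Field K] [NumberField K] {hcpt : isCompact_glFiniteIntegralLevel 2 K}
  {E : Type*} [NormedAddCommGroup E] [InnerProductSpace ℂ E] [CompleteSpace E]
  {τ : ContRepresentation ℂ (AutomorphyDatum.gl 2 K hcpt).arch.carrier E}

set_option maxHeartbeats 1600000 in
/-- **The tagged archimedean test vector with its unitarity data.** For an irreducible unitary strongly
continuous `τ` of `GL₂(K_∞)` with a non-zero continuous Whittaker functional `ℓ`: a non-zero `K_∞`-finite
Gårding vector `e`, tagged at every real place (`RealTagged`, sign `δ_w = realPlaceGL reflGLR`) and every complex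
place (`ComplexTagged`), whose Kirillov function FACTORS as `C ∏_w S_{t_w}(u_w) ∏_w S_{t_w}(u_w)` (`C ≠ 0`,
`realShapeOf`, `complexShapeOf` — `ArchHeckeTestVectorConstructionGL2`, `ArchKirillovFactorisationGL2`), together
with the central scalars of the places and the UNITARITY BOUNDS on the parameters of its tags in the refined form
of `ArchRankinSelbergGammaTaggedGL2`: `re μ_w = 0`; `discPlus k`: `k ≥ 1`; `weightOneSym κ`: `re κ = 0`; `weightZero`:
`|im ν| < ½`; `weightZeroX`: `|im ν| ≤ ½` (`ArchUnitarityBoundsGL2Real`); `re μ₁ = re μ₂ = 0`,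
`|im ν^a|, |im ν^h| ≤ m/2 + 1`, `holPow b`: `|im ν^a| < m/2+1`, `antiPowLowest 0`: `|im ν^h| < m/2+1`, `string j`:
`im ν^a = m/2 ∧ j ≤ m` (`ArchUnitarityBoundsGL2Complex`). The test-vector input (R3) of the Humphries–Jo
Rankin–Selberg computation for `GL₂ × GL₂`: the same vector serves `τ` whatever the partner `τ'`.
[cite: JacquetLanglands1970, §5 Thm. 5.15, §6 Thm. 6.4, proof of Thm. 11.1] [cite: HumphriesJo2024, Thm. 5.6] -/
theorem exists_taggedTestVector_unitarityData (hτ : τ.IsStronglyContinuous) (hτu : τ.IsUnitary) (hτi : τ.IsTopIrreducible)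
    {ℓ : archGardingSpace hcpt τ →ₗ[ℂ] ℂ} (hℓW : IsArchContWhittakerFunctional hcpt τ hτ ℓ) (hne : ℓ ≠ 0) :
    ∃ (e : archGardingSpace hcpt τ) (μR νR lamR : {w : InfinitePlace K // IsReal w} → ℂ)
      (tR : {w : InfinitePlace K // IsReal w} → RealTag)
      (μ₁ μ₂ : {w : InfinitePlace K // IsComplex w} → ℂ) (m : {w : InfinitePlace K // IsComplex w} → ℕ)
      (νa νh : {w : InfinitePlace K // IsComplex w} → ℂ) (tC : {w : InfinitePlace K // IsComplex w} → ComplexTag) (C : ℂ),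
      e ∈ archKFinite hτ ∧ e ≠ 0 ∧ C ≠ 0 ∧
      (∀ w, RealTagged hτ w (realPlaceGL K w reflGLR) (μR w) (lamR w) (tR w) e) ∧
      (∀ w, ComplexTagged hτ w (m w) (μ₂ w) (tC w) e) ∧
      (∀ w (v : archGardingSpace hcpt τ),
        gardingEnd hτ (Matrix.single 0 0 ((Pi.single w 1, 0) : mixedSpace K)) v +
          gardingEnd hτ (Matrix.single 1 1 ((Pi.single w 1, 0) : mixedSpace K)) v = μR w • v) ∧
      (∀ w (v : archGardingSpace hcpt τ), gardingEnd hτ (Matrix.single 0 0 ((0, Pi.single w 1) : mixedSpace K) +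
          Matrix.single 1 1 ((0, Pi.single w 1) : mixedSpace K)) v = μ₁ w • v) ∧
      (∀ w (v : archGardingSpace hcpt τ), gardingEnd hτ (Matrix.single 0 0 ((0, Pi.single w Complex.I) : mixedSpace K) +
          Matrix.single 1 1 ((0, Pi.single w Complex.I) : mixedSpace K)) v = μ₂ w • v) ∧
      (∀ w, (μR w).re = 0) ∧
      (∀ w, match tR w with
        | .discPlus k => 1 ≤ k
        | .weightOneSym κ => κ.re = 0
        | .weightZero => |(νR w).im| < 1 / 2
        | .weightZeroX => |(νR w).im| ≤ 1 / 2) ∧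
      (∀ w, (μ₁ w).re = 0) ∧ (∀ w, (μ₂ w).re = 0) ∧
      (∀ w, |(νa w).im| ≤ (m w : ℝ) / 2 + 1) ∧ (∀ w, |(νh w).im| ≤ (m w : ℝ) / 2 + 1) ∧
      (∀ w, match tC w with
        | .holPow _ => |(νa w).im| < (m w : ℝ) / 2 + 1
        | .antiPowLowest b => b = 0 → |(νh w).im| < (m w : ℝ) / 2 + 1
        | .string j => (νa w).im = (m w : ℝ) / 2 ∧ j ≤ m w) ∧
      ∀ u : (mixedSpace K)ˣ, kirillovFn hτ ℓ e u =
        C * ((∏ w, realShapeOf (μR w) (νR w) (tR w) ((u : mixedSpace K).1 w)) *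
          ∏ w, complexShapeOf (μ₁ w) (m w) (νa w) (νh w) (tC w) ((u : mixedSpace K).2 w)) := by
  -- the real signs
  set δf : {w : InfinitePlace K // IsReal w} → GL (Fin 2) (mixedSpace K) := fun w => realPlaceGL K w reflGLR with hδf_def
  have hδf : ∀ w, (δf w : Matrix (Fin 2) (Fin 2) (mixedSpace K)) = 1 - (2 : ℝ) • Matrix.single (0 : Fin 2) (0 : Fin 2) ((Pi.single w 1, 0) : mixedSpace K) :=
    fun w => coe_realPlaceGL_reflGLR (K := K) w
  -- the scalars of the places
  choose μR hμR using fun w => exists_realCentral hτ hτu hτi w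
  choose lamR hlamR using fun w => exists_placeCasimirReal_gardingEnd_eq_smul hτ hτu hτi w
  choose νR hνR using fun w => exists_eq_sub_two_mul_sq (μR w ^ 2 / 2 - 1 / 2) (lamR w)
  have hνR' : ∀ w, lamR w = μR w ^ 2 / 2 - 2 * νR w ^ 2 - 1 / 2 := fun w => by rw [hνR w]; ring
  choose μ₁ hZ1 using fun w => (exists_complexCentral hτ hτu hτi w).1
  choose μ₂ hZ2 using fun w => (exists_complexCentral hτ hτu hτi w).2
  choose lamh hCh using fun w => (exists_placeCasimirHolAnti_gardingEnd_eq_smul hτ hτu hτi w).1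
  choose lama hCa using fun w => (exists_placeCasimirHolAnti_gardingEnd_eq_smul hτ hτu hτi w).2
  choose νC' hνC' using fun w => exists_eq_sub_two_mul_sq ((μ₁ w - Complex.I * μ₂ w) ^ 2 / 2 - 2) (lamh w)
  have hlamh : ∀ w, lamh w = (μ₁ w - Complex.I * μ₂ w) ^ 2 / 2 - 2 * νC' w ^ 2 - 2 := fun w => by rw [hνC' w]; ring
  -- the base vector and the exact relations
  obtain ⟨x, k, m, hbc, hk0, hsign, hone, htwo, hdesc⟩ := exists_isBaseCandidate_normalForm' hτ hτu hτi hℓW hne hδf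
  have hx0 : x ≠ 0 := hbc.ne_zero
  have hxK : x ∈ archKFinite hτ := hbc.kFinite
  have hnull : ∀ v ∈ archKFinite hτ, v ∈ kirillovNull hτ ℓ → v = 0 := fun v hv hvS => by
    by_contra h; exact not_mem_kirillovNull_of_mem_archKFinite hτ hτu hτi hℓW hne hv h hvS
  obtain ⟨kx, hkx⟩ : ∃ kx : {w : InfinitePlace K // IsReal w} → ℕ, ∀ w, ((kx w : ℕ) : ℤ) = k w :=
    ⟨fun w => (k w).toNat, fun w => Int.toNat_of_nonneg (hk0 w)⟩
  have hkcast : ∀ w, ((kx w : ℕ) : ℂ) = (k w : ℂ) := fun w => by rw [← hkx w]; norm_cast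
  have hLoK : ∀ w, (gardingEnd hτ (Matrix.single (0 : Fin 2) (0 : Fin 2) ((Pi.single w 1, 0) : mixedSpace K) - Matrix.single (1 : Fin 2) (1 : Fin 2) ((Pi.single w 1, 0) : mixedSpace K)) -
      Complex.I • gardingEnd hτ (Matrix.single (0 : Fin 2) (1 : Fin 2) ((Pi.single w 1, 0) : mixedSpace K) + Matrix.single (1 : Fin 2) (0 : Fin 2) ((Pi.single w 1, 0) : mixedSpace K))) x ∈
      archKFinite hτ := fun w =>
    Submodule.sub_mem _ (gardingEnd_mem_archKFinite hτ _ hxK) (Submodule.smul_mem _ _ (gardingEnd_mem_archKFinite hτ _ hxK))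
  have hRraw : ∀ w, RealRaw hτ w (δf w) x (kx w) (2 * lamR w - μR w ^ 2 + 1) := by
    intro w
    refine ⟨by rw [hkcast]; exact hbc.weylR w, fun hk => hsign w (by rw [← hkx w, hk]; rfl), fun hk => ?_⟩
    rcases Nat.lt_or_ge 1 (kx w) with h2 | h2
    · have hk2 : 2 ≤ k w := by rw [← hkx w]; exact_mod_cast h2
      exact Or.inl (hnull _ (hLoK w) (htwo w hk2))
    · have hk1 : kx w = 1 := le_antisymm h2 hk
      have hk1' : k w = 1 := by rw [← hkx w, hk1]; rfl
      rcases hone w hk1' with h3 | h3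
      · refine Or.inr ⟨hk1, fun hsR => h3 ?_⟩
        have h4 := raising_lowering_apply hτ w 1 (μR w) (lamR w) x (by rw [mul_one]; have := hbc.weylR w; rwa [hk1', Int.cast_one, mul_one] at this)
          (hμR w x) (hlamR w x)
        rw [h4, show 2 * lamR w - μR w ^ 2 - 1 ^ 2 + 2 * 1 = 2 * lamR w - μR w ^ 2 + 1 by ring, hsR, zero_smul]
      · exact Or.inl (hnull _ (hLoK w) h3)
  have hCraw : ∀ w, ComplexRaw hτ w x (m w) := fun w =>
    ⟨hbc.raising w, hbc.torusC w, fun hm => hnull _ (descentOp_mem_archKFinite hτ w _ hxK) (hdesc w hm)⟩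
  -- the Bessel parameters of the complex places, with the string relation
  have hνC_ex : ∀ w, ∃ ν : ℂ, lama w = (μ₁ w + Complex.I * μ₂ w) ^ 2 / 2 - 2 * ν ^ 2 - 2 ∧
      (2 ≤ m w → lamh w = (μ₁ w - Complex.I * μ₂ w) ^ 2 / 2 - 2 * (ν - Complex.I * m w) ^ 2 - 2) := by
    intro w
    by_cases hm : 2 ≤ m w
    · obtain ⟨ν, h1, h2⟩ := exists_string_relation hτu hτi hℓW hne (hZ1 w) (hZ2 w) (hCa w) (hCh w) hxK hx0 (hCraw w) hm
      exact ⟨ν, h1, fun _ => h2⟩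
    · obtain ⟨ν, hν⟩ := exists_eq_sub_two_mul_sq ((μ₁ w + Complex.I * μ₂ w) ^ 2 / 2 - 2) (lama w)
      exact ⟨ν, by rw [hν]; ring, fun h => absurd h hm⟩
  choose νC hlama hrelm using hνC_ex
  have hrel : ∀ w (j : ℕ), 0 < j → j < m w → lamh w = (μ₁ w - Complex.I * μ₂ w) ^ 2 / 2 - 2 * (νC w - Complex.I * m w) ^ 2 - 2 :=
    fun w j hj hjm => hrelm w (by omega)
  -- the test vector
  obtain ⟨e, heK, he0, hRF, hCF, -⟩ := exists_final_of_raw (hτ := hτ) hτu hτi hℓW hne hδf hμR hlamR hZ2 hxK hx0 hRraw hCraw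
  choose tagR htagR using fun w => exists_realTag (hRF w)
  choose tagC htagC using fun w => exists_complexTag (hCF w)
  -- the factorisation of its Kirillov function
  have hrigR : ∀ w, RigidRealAt (kirillovFn hτ ℓ e) w (realShapeOf (μR w) (νR w) (tagR w)) := fun w =>
    RealTagged.rigid hτu hℓW (hδf w) (νR w) (hνR' w) (htagR w)
  have hrigC : ∀ w, RigidComplexAt (kirillovFn hτ ℓ e) w (complexShapeOf (μ₁ w) (m w) (νC w) (νC' w) (tagC w)) := fun w =>
    ComplexTagged.rigid hτu hℓW (hlama w) (hlamh w) (hZ1 w) (hZ2 w) (hCa w) (hCh w) (hrel w) (htagC w)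
  obtain ⟨C, hC⟩ := exists_eq_const_mul_prod_of_rigid hrigR hrigC
  have hC0 : C ≠ 0 := by
    intro h0
    refine not_mem_kirillovNull_of_mem_archKFinite hτ hτu hτi hℓW hne heK he0 fun u => ?_
    rw [hC u, h0, zero_mul]
  -- ### the unitarity data
  -- real places
  have hμRre : ∀ w, (μR w).re = 0 := fun w => by
    have h := hμR w e
    rw [← LinearMap.add_apply, ← gardingEnd_add] at h
    exact re_eq_zero_of_gardingEnd_eq_smul hτ hτu _ he0 h
  have hadmR : ∀ w, match tagR w with
      | .discPlus k => 1 ≤ k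
      | .weightOneSym κ => κ.re = 0
      | .weightZero => |(νR w).im| < 1 / 2
      | .weightZeroX => |(νR w).im| ≤ 1 / 2 := by
    intro w
    have ht := htagR w
    revert ht
    generalize tagR w = t
    intro ht
    cases t with
    | discPlus k => exact ht.1
    | weightOneSym κ =>
      have h : RealWeightOneSym hτ w (δf w) e 1 κ (μR w) (lamR w) := ht
      obtain ⟨v', hW', hZ', hC', hev⟩ := h.exists_inner
      have hv0 : v' ≠ 0 := by
        intro h0
        apply he0
        rw [hev, h0]
        simp only [map_zero, smul_zero, add_zero]
      exact re_weightOneParam_eq_zero hτ w hτu (μR w) (lamR w) κ h.kappa_sq hv0 hW' hZ' hC'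
    | weightZero =>
      have h : RealWeightZero hτ w (δf w) e 1 (μR w) (lamR w) := ht
      exact abs_im_besselParam_lt_half hτ w hτu hτi hℓW hne (μR w) (lamR w) (νR w) (hνR' w) heK he0 h.weyl h.centre h.casimir
    | weightZeroX =>
      have h : RealWeightZeroX hτ w (δf w) e 1 (μR w) (lamR w) := ht
      obtain ⟨v', hW', hZ', hC', -, hev⟩ := h.exists_inner
      have hv0 : v' ≠ 0 := by
        intro h0
        apply he0
        rw [hev, h0, map_zero]
      exact abs_im_besselParam_le_half hτ w hτu (μR w) (lamR w) (νR w) (hνR' w) hv0 hW' hZ' hC'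
  -- complex places: the inner highest vector of the tag
  have hinner : ∀ w, ∃ y : archGardingSpace hcpt τ, y ≠ 0 ∧ ComplexInner hτ w y (m w) ∧
      (match tagC w with
        | .holPow b => e = ((gardingEnd hτ (Matrix.single (0 : Fin 2) (1 : Fin 2) ((0, Pi.single w 1) : mixedSpace K)) -
            Complex.I • gardingEnd hτ (Matrix.single (0 : Fin 2) (1 : Fin 2) ((0, Pi.single w Complex.I) : mixedSpace K))) ^ b) y
        | .antiPowLowest b => e = ((gardingEnd hτ (Matrix.single (0 : Fin 2) (1 : Fin 2) ((0, Pi.single w 1) : mixedSpace K)) +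
            Complex.I • gardingEnd hτ (Matrix.single (0 : Fin 2) (1 : Fin 2) ((0, Pi.single w Complex.I) : mixedSpace K))) ^ b)
            ((((gardingEnd hτ (Matrix.single (1 : Fin 2) (0 : Fin 2) ((0, Pi.single w 1) : mixedSpace K)) -
              Complex.I • gardingEnd hτ (Matrix.single (1 : Fin 2) (0 : Fin 2) ((0, Pi.single w Complex.I) : mixedSpace K))) -
              (gardingEnd hτ (Matrix.single (0 : Fin 2) (1 : Fin 2) ((0, Pi.single w 1) : mixedSpace K)) +
              Complex.I • gardingEnd hτ (Matrix.single (0 : Fin 2) (1 : Fin 2) ((0, Pi.single w Complex.I) : mixedSpace K)))) ^ (m w)) y)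
        | .string j => 0 < j ∧ j < m w) := by
    intro w
    have ht := htagC w
    revert ht
    generalize tagC w = t
    intro ht
    cases t with
    | holPow b =>
      obtain ⟨y, hy, hev⟩ := ht.1.exists_inner
      refine ⟨y, fun h0 => he0 ?_, hy, hev⟩
      rw [hev, h0, map_zero]
    | antiPowLowest b =>
      obtain ⟨y, hy, hev⟩ := ht.1.exists_inner
      refine ⟨y, fun h0 => he0 ?_, hy, hev⟩
      rw [hev, h0, map_zero, map_zero]
    | string j =>
      obtain ⟨hj, hjm, hs, -⟩ := ht
      obtain ⟨y, hy, hev⟩ := hs.exists_inner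
      refine ⟨y, fun h0 => he0 ?_, hy, hj, hjm⟩
      rw [hev, h0, map_zero]
  have hμ₁re : ∀ w, (μ₁ w).re = 0 := fun w => (re_complexCentral_eq_zero hτ w hτu (hZ1 w) (hZ2 w) he0).1
  have hμ₂re : ∀ w, (μ₂ w).re = 0 := fun w => (re_complexCentral_eq_zero hτ w hτu (hZ1 w) (hZ2 w) he0).2
  have hconj : ∀ w, conj (lama w) = lamh w := fun w => conj_placeCasimirAnti_eq hτ w hτu he0 (hCa w e) (hCh w e)
  have hle : ∀ w, |(νC w).im| ≤ (m w : ℝ) / 2 + 1 := fun w => by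
    obtain ⟨y, hy0, hy, -⟩ := hinner w
    have h := abs_im_besselParamC_le hτ w hτu (hZ1 w) (hZ2 w) (hCa w) (hCh w) (hlama w) hy0 hy.1 hy.2.1
    linarith
  have hle' : ∀ w, |(νC' w).im| ≤ (m w : ℝ) / 2 + 1 := fun w => by
    obtain ⟨-, him, -⟩ := besselParamC_sq_eq_conj_sq (hμ₁re w) (hμ₂re w) (hconj w) (hlama w) (hlamh w)
    rw [him]; exact hle w
  have hadmC : ∀ w, match tagC w with
      | .holPow _ => |(νC w).im| < (m w : ℝ) / 2 + 1
      | .antiPowLowest b => b = 0 → |(νC' w).im| < (m w : ℝ) / 2 + 1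
      | .string j => (νC w).im = (m w : ℝ) / 2 ∧ j ≤ m w := by
    intro w
    have hin := hinner w
    revert hin
    generalize tagC w = t
    intro hin
    obtain ⟨y, hy0, hy, hrest⟩ := hin
    cases t with
    | holPow b =>
      have hev : e = ((gardingEnd hτ (Matrix.single (0 : Fin 2) (1 : Fin 2) ((0, Pi.single w 1) : mixedSpace K)) -
          Complex.I • gardingEnd hτ (Matrix.single (0 : Fin 2) (1 : Fin 2) ((0, Pi.single w Complex.I) : mixedSpace K))) ^ b) y := hrest
      rcases Nat.eq_zero_or_pos b with hb | hb
      · -- `e = y` is `K_∞`-finite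
        rw [hb, pow_zero, Module.End.one_apply] at hev
        have hyK : y ∈ archKFinite hτ := hev ▸ heK
        have h := (complexPlace_unitarityBounds hτ w hτu hτi hℓW hne (hZ1 w) (hZ2 w) (hCa w) (hCh w) (hlama w) (hlamh w) hyK hy0 hy.1 hy.2.1).2.2.2.1
        show |(νC w).im| < (m w : ℝ) / 2 + 1
        linarith
      · -- `τ^h(E₀₁) y ≠ 0`
        have hne' : (gardingEnd hτ (Matrix.single (0 : Fin 2) (1 : Fin 2) ((0, Pi.single w 1) : mixedSpace K)) -
            Complex.I • gardingEnd hτ (Matrix.single (0 : Fin 2) (1 : Fin 2) ((0, Pi.single w Complex.I) : mixedSpace K))) y ≠ 0 := by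
          intro h0
          apply he0
          obtain ⟨b', rfl⟩ := Nat.exists_eq_succ_of_ne_zero hb.ne'
          rw [hev, pow_succ, Module.End.mul_apply, h0, map_zero]
        have h := abs_im_besselParamC_lt_of_ne hτ w hτu (hZ1 w) (hZ2 w) (hCa w) (hCh w) (hlama w) hy0 hy.1 hy.2.1 hne'
        show |(νC w).im| < (m w : ℝ) / 2 + 1
        linarith
    | antiPowLowest b =>
      intro hb
      have hev : e = ((gardingEnd hτ (Matrix.single (0 : Fin 2) (1 : Fin 2) ((0, Pi.single w 1) : mixedSpace K)) +
            Complex.I • gardingEnd hτ (Matrix.single (0 : Fin 2) (1 : Fin 2) ((0, Pi.single w Complex.I) : mixedSpace K))) ^ b)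
            ((((gardingEnd hτ (Matrix.single (1 : Fin 2) (0 : Fin 2) ((0, Pi.single w 1) : mixedSpace K)) -
              Complex.I • gardingEnd hτ (Matrix.single (1 : Fin 2) (0 : Fin 2) ((0, Pi.single w Complex.I) : mixedSpace K))) -
              (gardingEnd hτ (Matrix.single (0 : Fin 2) (1 : Fin 2) ((0, Pi.single w 1) : mixedSpace K)) +
              Complex.I • gardingEnd hτ (Matrix.single (0 : Fin 2) (1 : Fin 2) ((0, Pi.single w Complex.I) : mixedSpace K)))) ^ (m w)) y) := hrest
      rw [hb, pow_zero, Module.End.one_apply] at hev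
      -- the Weyl rotation maps `y` to `c • e`, so `y` is a `K_∞`-translate of `e`, hence `K_∞`-finite
      obtain ⟨c, hc0, hRy⟩ := hy.2.2.2
      rw [← hev] at hRy
      set Rg : GL (Fin 2) (mixedSpace K) := expGL ((Real.pi / 2 : ℝ) •
        (Matrix.single (0 : Fin 2) (1 : Fin 2) ((0, Pi.single w 1) : mixedSpace K) -
          Matrix.single (1 : Fin 2) (0 : Fin 2) ((0, Pi.single w 1) : mixedSpace K))) with hRg
      have hRgK : Rg ∈ Kinf 2 K := expGL_smul_mem_Kinf ((star_letters (K := K)).2.2.1 w) _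
      have hy_eq : y = c • gardingAct hτ Rg⁻¹ e := by
        have h1 : gardingAct hτ Rg⁻¹ (gardingAct hτ Rg y) = y := by
          rw [← Module.End.mul_apply, ← gardingAct_mul, inv_mul_cancel, gardingAct_one, Module.End.one_apply]
        rw [← h1, hRy, map_smul]
      have hyK : y ∈ archKFinite hτ := by
        rw [hy_eq]
        exact Submodule.smul_mem _ _ (gardingAct_mem_archKFinite hτ (Subgroup.inv_mem _ hRgK) heK)
      have h := (complexPlace_unitarityBounds hτ w hτu hτi hℓW hne (hZ1 w) (hZ2 w) (hCa w) (hCh w) (hlama w) (hlamh w) hyK hy0 hy.1 hy.2.1).2.2.2.2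
      linarith
    | string j =>
      obtain ⟨hj, hjm⟩ := hrest
      have hm : m w ≠ 0 := by omega
      exact ⟨im_besselParamC_eq_half_of_string hm (hμ₁re w) (hμ₂re w) (hconj w) (hlama w) (hrel w j hj hjm), hjm.le⟩
  exact ⟨e, μR, νR, lamR, tagR, μ₁, μ₂, m, νC, νC', tagC, C, heK, he0, hC0, htagR, htagC, hμR, hZ1, hZ2, hμRre, hadmR,
    hμ₁re, hμ₂re, hle, hle', hadmC, hC⟩

end Literature.NumberTheory.Automorphic
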